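import Summits.QuantumFields.BalabanUV.Beta.FP.ResidualModeLoewner
import Literature.MathematicalPhysics.QuantumFieldTheory.Balaban1983to89.Beta.KKTSplit
import Literature.MathematicalPhysics.QuantumFieldTheory.Balaban1983to89.B9Eq3112
import Summits.QuantumFields.BalabanUV.Beta.FP.SliceSaturation

/-!
# `BalabanUV.Beta.FP.SelfSimilarBordering` — road «FP» for binder row D1, row **RHOA-9** (MODEL; owner d1-p3-g6's `RHOA-DESIGN.md` §4 ∕ §5,
# journal l.23030): the SELF-SIMILAR BORDERING H‴ `H′ = H_cov + QᵀGQ` of Bałaban's covariant one shot at MODEL level — its zero-mode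
# bookkeeping, its invertibility criterion, its TWO-DETERMINANT form of `log Z`, and the junction with H″'s three-plus-one determinants

HONEST DEPENDENCY (page 1, mandatory): continuum YM on T⁴ ⇐ BetaPertH ∧ nine spine estimates (0/9 proved); BetaPertH ⇐ (D1) ∧ (D4) ∧
CAP+tail; G-an2-4 gates asym, D1 and NE2/3/4.  HONEST FRAMING (cell contract, verbatim): «discharging `BetaPertH` makes Bałaban's UV
stability UNCONDITIONAL — a real constructive-QFT result; it is NOT the continuum limit and NOT the Clay problem.»  THIS MODULE is [folklore]
finite-dimensional linear algebra over `ℝ` on the cell's own bordered-inverse dictionary (`Beta.Composition.kkt ∕ blockProp ∕ logZ`,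
`Beta.CompositionSingular.flucCov ∕ effForm ∕ minOp`, `Beta.Envelope.minMap`, `Beta.KKTSplit`, `B9Eq3112.isUnit_det_QHinvQt`), the owner's
`FP/SliceSaturation` (RHOA-1a) and the lineage's IR-3-ID parts 1–3 (`FP/ResidualModeIdentities` ∕ `…Determinant` ∕ `…Loewner`) BY NAME; MODEL level; no `def`, no `def … : Prop`, nothing cited, 0 `sorry`; 0 estimates of
Bałaban's; the fixed-point saturation S2 ∕ RHOA-1 (`(QH′⁻¹Qᵀ)⁻¹ = n⁻⁴(D²S_∞ + d^cd^{c*})`) is NOT asserted and NOT used; 0∕4 binders of row D1; NOT hbook,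
NOT hasym, NOT D1, NOT BetaPertH, NOT continuum, NOT Clay.

ABSOLUTE RULE (cell charter, verbatim): «No internally-minted statement may enter as a cited fact. Every hypothesis is either kernel-proved in this
package or a verbatim quotation of a PUBLISHED theorem with page reference. The manuscript(s) under audit are NOT citable for their own disputed
steps — they are the thing under adjudication; programme-internal (2001/route/tribunal) claims are never citable.»

THE READING (RHOA-DESIGN §4; orientation only, nothing of it is asserted here).  «`H′_n(B) := H_cov(B) + n⁻⁴·Q_Bᵀ(d^c_Vd^{c*}_V)Q_B` is invertible
at `B = 𝟙` (zero modes of `H_cov(𝟙)` are `dΔ⁻²Q′ᵀβ`, on which the added term is `Δ^cMidβ ≠ 0`), agrees with `H_cov` on `ker Q_B` … hence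
`log Z^{cov,gl}_n(V) = −½log det H′_n(U_nV) + ½log det H^c_BF(V) + c`: TWO determinants … Conservation of difficulty … recorded because (a) it proves at
MODEL level that …; (b) if IR-3-RG stalls, H‴ trades `R^g` for a second Woodbury row of the SAME capacitance type as `R^Q`.  Row RHOA-9 (model).»
Letters of parts 1–3: `H ≻ 0` (the full-BF fine form), raw deficit rows `F` with `F H⁻¹ Fᵀ = Mid` invertible, `H_cov := H − FᵀMid⁻¹F`, `S₀ := QH⁻¹Fᵀ`
(`= d^c·Mid`), `Γ₀ := flucCov H Q`, `K_C⁻¹ := Mid − FΓ₀Fᵀ`; a coarse form `G : Matrix μ μ ℝ` (`= n⁻⁴d^cd^{c*}` in the reading); `H′ := H_cov + QᵀGQ`.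

CONTENT.
* §1 THE ZERO MODES EXACTLY: `H_cov = (1 − FᵀMid⁻¹FH⁻¹)·H·(1 − FᵀMid⁻¹FH⁻¹)ᵀ` (square-root-free congruence), hence **`H_cov ⪰ 0`** and
  **`H_cov v = 0 ⟺ ∃ β, v = H⁻¹Fᵀβ`** (⊇ is part 3's `downdate_mul_inv_mul_transpose`) — the `|κ|` modes and nothing else.
* §2 **`(H_cov + QᵀGQ) ≻ 0 ⟺ ∀ β ≠ 0, 0 < (S₀β) ⬝ G(S₀β)`** for `G ⪰ 0` — H‴ is invertible iff the coarse gauge fixing is positive on the `S₀`-image; with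
  `G ≻ 0` this is `S₀` injective, the SAME condition as part 3's `posDef_weight_sub_deficitCov_iff` for H″'s residual-mode matrix `K_C⁻¹ ≻ 0`.
* §3 THE TWO-DETERMINANT FORM: `logZ H_cov Q = ((|ν|−|μ|)/2)log 2π − ½log|det H′| − ½log|det(QH′⁻¹Qᵀ)|` (`KKTSplit.logZ_split_reg` BY NAME, its hypotheses
  discharged by §2 and `B9Eq3112.isUnit_det_QHinvQt` for `Q` onto), and THE JUNCTION with part 2's `logZ_sub_deficit_three`:
  **`½log|det H| + ½log|det(QH⁻¹Qᵀ)| + ½log|det K_C⁻¹| − ½log|det Mid| = ½log|det H′| + ½log|det(QH′⁻¹Qᵀ)|`** for EVERY admissible `G`.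
* §4 THE VARIATIONAL READING (the ALGEBRA of §4's «`min_{Q_Bφ=a}⟨φ,H′_nφ⟩ = …`»; `Beta.Envelope` BY NAME): on the fibre `Qφ = a` the coarse gauge
  fixing is the constant `a ⬝ Ga`, whence **`min_{Qφ=a} φ ⬝ H_cov φ = a ⬝ ((QH′⁻¹Qᵀ)⁻¹ − G) a`**, attained at the Lagrange minimiser `minMap H′ Q a` — for EVERY
  admissible `G`; the fixed-point VALUE `n⁻⁴D²S_∞` (S2 ∕ RHOA-1) is NOT asserted.
* §5 UNDER RHOA-1a's SATURATION LETTERS (the owner's `FP/SliceSaturation` p241905, imported BY NAME as asked in the GO l.23656 (6)): H‴ ≻ 0 and `Q`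
  onto ⟹ `IsUnit (kkt Hc Q).det` for ANY `Hc` (the bordered determinant does not see `QᵀGQ`); with `Hc := H₀ + EᵀE` saturated,
  **`effForm (Hc + QᵀGQ) Q = minOpᵀ·H₀·minOp + G`** and **`(QH′⁻¹Qᵀ)⁻¹ = S + G`, `min_{Qφ=a}⟨φ,H′φ⟩ = ⟨a,(S + G)a⟩`** attained at `minMap H′ Q a`
  (`S := minOpᵀH₀minOp` the gauge-invariant value form; its fixed-point VALUE S1 is NOT asserted).
Provenance: NE9 formalisation swarm (idle-seat cross-lane duty NE9 → road FP), unit b2b-balaban-t4-ne9-formalise-leaf-08 gen 29, 2026-08-20.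
[folklore], 0 def, 0 cite, 0 sorry.
-/

namespace Summit.QuantumFields.BalabanUV.Beta.FP.SelfSimilarBordering

open scoped Matrix
open Matrix
open Literature.MathematicalPhysics.QuantumFieldTheory.Balaban1983to89.Beta.Composition (kkt blockProp logZ det_kkt_ne_zero)
open Literature.MathematicalPhysics.QuantumFieldTheory.Balaban1983to89.Beta.CompositionSingular (flucCov effForm minOp effForm_add_conj
  effForm_eq_blockProp_inv)
open Literature.MathematicalPhysics.QuantumFieldTheory.Balaban1983to89.Beta.KKTSplit (det_kkt_add_conj)
open Summit.QuantumFields.BalabanUV.Beta.FP.SliceSaturation (effForm_eq_valueForm_of_saturated)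
open Literature.MathematicalPhysics.QuantumFieldTheory.Balaban1983to89.Beta.Envelope (minMap constraint_mul_minMap transpose_minMap_mul_mul_minMap quad_minMap_le)
open Summit.QuantumFields.BalabanUV.Beta.FP.ResidualModeIdentities (dotProduct_mulVec_sq_le)
open Summit.QuantumFields.BalabanUV.Beta.FP.ResidualModeLoewner (downdate_mul_inv_mul_transpose)

variable {κ ν μ : Type*} [Fintype κ] [Fintype ν] [Fintype μ] [DecidableEq κ] [DecidableEq ν] [DecidableEq μ]

/-! ## §1 The zero modes of the downdated fine form, exactly -/

/-- [folklore] **CONGRUENCE**: `H − FᵀMid⁻¹F = (1 − FᵀMid⁻¹FH⁻¹)·H·(1 − FᵀMid⁻¹FH⁻¹)ᵀ` (symmetric invertible `H`, `F H⁻¹ Fᵀ = Mid` invertible). -/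
theorem downdate_eq_congruence (H : Matrix ν ν ℝ) (F : Matrix κ ν ℝ) (Mid : Matrix κ κ ℝ) (hHs : Hᵀ = H) (hH : IsUnit H.det)
    (hF : F * H⁻¹ * Fᵀ = Mid) (hMid : IsUnit Mid.det) :
    H - Fᵀ * Mid⁻¹ * F = (1 - Fᵀ * Mid⁻¹ * F * H⁻¹) * H * (1 - Fᵀ * Mid⁻¹ * F * H⁻¹)ᵀ := by
  have hHis : (H⁻¹)ᵀ = H⁻¹ := by rw [transpose_nonsing_inv, hHs]
  have hMs : Midᵀ = Mid := by rw [← hF]; simp only [transpose_mul, transpose_transpose, hHis, Matrix.mul_assoc]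
  have hMis : (Mid⁻¹)ᵀ = Mid⁻¹ := by rw [transpose_nonsing_inv, hMs]
  have hT : (1 - Fᵀ * Mid⁻¹ * F * H⁻¹)ᵀ = 1 - H⁻¹ * Fᵀ * Mid⁻¹ * F := by
    rw [transpose_sub, transpose_one]; simp only [transpose_mul, transpose_transpose, hMis, hHis, Matrix.mul_assoc]
  have e1 : (1 - Fᵀ * Mid⁻¹ * F * H⁻¹) * H = H - Fᵀ * Mid⁻¹ * F := by
    rw [Matrix.sub_mul, Matrix.one_mul, Matrix.mul_assoc (Fᵀ * Mid⁻¹ * F), Matrix.nonsing_inv_mul H hH, Matrix.mul_one]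
  have e2 : (H - Fᵀ * Mid⁻¹ * F) * (H⁻¹ * Fᵀ * Mid⁻¹ * F) = 0 := by
    have : (H - Fᵀ * Mid⁻¹ * F) * (H⁻¹ * Fᵀ * Mid⁻¹ * F) = ((H - Fᵀ * Mid⁻¹ * F) * (H⁻¹ * Fᵀ)) * (Mid⁻¹ * F) := by
      simp only [Matrix.mul_assoc]
    rw [this, downdate_mul_inv_mul_transpose H F Mid hH hMid hF, Matrix.zero_mul]
  rw [hT, e1, Matrix.mul_sub, Matrix.mul_one, e2, sub_zero]

/-- [folklore] **`H_cov ⪰ 0`** for `H ≻ 0` (a congruence of `H`). -/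
theorem posSemidef_downdate (H : Matrix ν ν ℝ) (F : Matrix κ ν ℝ) (Mid : Matrix κ κ ℝ) (hH : H.PosDef)
    (hF : F * H⁻¹ * Fᵀ = Mid) (hMid : IsUnit Mid.det) : (H - Fᵀ * Mid⁻¹ * F).PosSemidef := by
  have hHu : IsUnit H.det := (Matrix.isUnit_iff_isUnit_det H).mp hH.isUnit
  have hHs : Hᵀ = H := by rw [← conjTranspose_eq_transpose_of_trivial]; exact hH.1
  rw [downdate_eq_congruence H F Mid hHs hHu hF hMid]
  have h := hH.posSemidef.mul_mul_conjTranspose_same (1 - Fᵀ * Mid⁻¹ * F * H⁻¹)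
  rwa [conjTranspose_eq_transpose_of_trivial] at h

/-- [folklore] **THE KERNEL OF `H_cov` IS EXACTLY THE `|κ|` MODES**: `H_cov v = 0 ⟺ ∃ β, v = H⁻¹Fᵀβ` (for `H ≻ 0`, `F H⁻¹ Fᵀ = Mid` invertible). -/
theorem downdate_mulVec_eq_zero_iff (H : Matrix ν ν ℝ) (F : Matrix κ ν ℝ) (Mid : Matrix κ κ ℝ) (hH : H.PosDef)
    (hF : F * H⁻¹ * Fᵀ = Mid) (hMid : IsUnit Mid.det) (v : ν → ℝ) :
    (H - Fᵀ * Mid⁻¹ * F) *ᵥ v = 0 ↔ ∃ β : κ → ℝ, v = (H⁻¹ * Fᵀ) *ᵥ β := by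
  have hHu : IsUnit H.det := (Matrix.isUnit_iff_isUnit_det H).mp hH.isUnit
  have hHs : Hᵀ = H := by rw [← conjTranspose_eq_transpose_of_trivial]; exact hH.1
  constructor
  · intro hv
    -- w := (1 − H⁻¹FᵀMid⁻¹F) v has ⟨w, Hw⟩ = ⟨v, H_cov v⟩ = 0, hence w = 0
    refine ⟨(Mid⁻¹ * F) *ᵥ v, ?_⟩
    have hq : v ⬝ᵥ (H - Fᵀ * Mid⁻¹ * F) *ᵥ v = 0 := by rw [hv, dotProduct_zero]
    rw [downdate_eq_congruence H F Mid hHs hHu hF hMid] at hq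
    set T : Matrix ν ν ℝ := 1 - Fᵀ * Mid⁻¹ * F * H⁻¹ with hTdef
    have hq' : (Tᵀ *ᵥ v) ⬝ᵥ H *ᵥ (Tᵀ *ᵥ v) = 0 := by
      rwa [← mulVec_mulVec, ← mulVec_mulVec, dotProduct_mulVec v T, ← mulVec_transpose] at hq
    have hw : Tᵀ *ᵥ v = 0 := by
      by_contra hne
      have hpos := hH.dotProduct_mulVec_pos hne
      rw [star_trivial, hq'] at hpos
      exact lt_irrefl _ hpos
    have hTt : Tᵀ = 1 - H⁻¹ * Fᵀ * Mid⁻¹ * F := by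
      have hHis : (H⁻¹)ᵀ = H⁻¹ := by rw [transpose_nonsing_inv, hHs]
      have hMs : Midᵀ = Mid := by rw [← hF]; simp only [transpose_mul, transpose_transpose, hHis, Matrix.mul_assoc]
      have hMis : (Mid⁻¹)ᵀ = Mid⁻¹ := by rw [transpose_nonsing_inv, hMs]
      rw [hTdef, transpose_sub, transpose_one]; simp only [transpose_mul, transpose_transpose, hMis, hHis, Matrix.mul_assoc]
    rw [hTt, sub_mulVec, one_mulVec, sub_eq_zero] at hw
    calc v = (H⁻¹ * Fᵀ * Mid⁻¹ * F) *ᵥ v := hw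
      _ = (H⁻¹ * Fᵀ) *ᵥ ((Mid⁻¹ * F) *ᵥ v) := by rw [mulVec_mulVec]; simp only [Matrix.mul_assoc]
  · rintro ⟨β, rfl⟩
    rw [mulVec_mulVec, downdate_mul_inv_mul_transpose H F Mid hHu hMid hF, zero_mulVec]

/-! ## §2 H‴ is invertible iff the coarse gauge fixing is positive on the `S₀`-image -/

omit [DecidableEq μ] in
/-- [folklore] **H‴ IS INVERTIBLE IFF THE COARSE GAUGE FIXING IS POSITIVE ON THE `S₀`-IMAGE**: for `H ≻ 0`, `F H⁻¹ Fᵀ = Mid` invertible and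
`G ⪰ 0`,  `(H − FᵀMid⁻¹F + QᵀGQ) ≻ 0 ⟺ ∀ β ≠ 0, 0 < (S₀β) ⬝ G (S₀β)`, `S₀ := QH⁻¹Fᵀ`. -/
theorem posDef_add_conj_iff (H : Matrix ν ν ℝ) (Q : Matrix μ ν ℝ) (F : Matrix κ ν ℝ)
    (Mid : Matrix κ κ ℝ) (G : Matrix μ μ ℝ) (hH : H.PosDef) (hF : F * H⁻¹ * Fᵀ = Mid) (hMid : IsUnit Mid.det) (hG : G.PosSemidef) :
    (H - Fᵀ * Mid⁻¹ * F + Qᵀ * G * Q).PosDef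
      ↔ ∀ β : κ → ℝ, β ≠ 0 → 0 < ((Q * H⁻¹ * Fᵀ) *ᵥ β) ⬝ᵥ G *ᵥ ((Q * H⁻¹ * Fᵀ) *ᵥ β) := by
  have hHu : IsUnit H.det := (Matrix.isUnit_iff_isUnit_det H).mp hH.isUnit
  have hHs : Hᵀ = H := by rw [← conjTranspose_eq_transpose_of_trivial]; exact hH.1
  have hcov := posSemidef_downdate H F Mid hH hF hMid
  have hQt : (Qᵀ)ᴴ = Q := by rw [conjTranspose_eq_transpose_of_trivial, transpose_transpose]
  have hQGQ : (Qᵀ * G * Q).PosSemidef := by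
    have h := hG.conjTranspose_mul_mul_same Q
    rwa [conjTranspose_eq_transpose_of_trivial] at h
  -- quadratic form of the sum
  have hsplit : ∀ v : ν → ℝ, v ⬝ᵥ (H - Fᵀ * Mid⁻¹ * F + Qᵀ * G * Q) *ᵥ v
      = v ⬝ᵥ (H - Fᵀ * Mid⁻¹ * F) *ᵥ v + (Q *ᵥ v) ⬝ᵥ G *ᵥ (Q *ᵥ v) := by
    intro v
    rw [add_mulVec, dotProduct_add, ← mulVec_mulVec, ← mulVec_mulVec, dotProduct_mulVec v Qᵀ, vecMul_transpose]
  -- `H⁻¹Fᵀβ = 0 ⟹ β = 0`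
  have hinjF : ∀ β : κ → ℝ, (H⁻¹ * Fᵀ) *ᵥ β = 0 → β = 0 := by
    intro β hβ
    have h1 : Mid *ᵥ β = 0 := by
      rw [← hF, Matrix.mul_assoc, ← mulVec_mulVec, hβ, mulVec_zero]
    have h2 := congrArg (Mid⁻¹ *ᵥ ·) h1
    simpa only [mulVec_mulVec, Matrix.nonsing_inv_mul Mid hMid, one_mulVec, mulVec_zero] using h2
  constructor
  · intro hpd β hβ
    have hv : (H⁻¹ * Fᵀ) *ᵥ β ≠ 0 := fun h0 => hβ (hinjF β h0)
    have hpos := hpd.dotProduct_mulVec_pos hv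
    rw [star_trivial, hsplit, mulVec_mulVec, downdate_mul_inv_mul_transpose H F Mid hHu hMid hF, zero_mulVec, dotProduct_zero,
      zero_add, mulVec_mulVec, ← Matrix.mul_assoc] at hpos
    simpa only [Matrix.mul_assoc] using hpos
  · intro hβ
    refine PosDef.of_dotProduct_mulVec_pos (hcov.1.add hQGQ.1) fun v hv => ?_
    rw [star_trivial, hsplit]
    have h1 : 0 ≤ v ⬝ᵥ (H - Fᵀ * Mid⁻¹ * F) *ᵥ v := by simpa using hcov.dotProduct_mulVec_nonneg v
    have h2 : 0 ≤ (Q *ᵥ v) ⬝ᵥ G *ᵥ (Q *ᵥ v) := by simpa using hG.dotProduct_mulVec_nonneg (Q *ᵥ v)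
    rcases (add_nonneg h1 h2).lt_or_eq with hlt | heq
    · exact hlt
    · exfalso
      have h1z : v ⬝ᵥ (H - Fᵀ * Mid⁻¹ * F) *ᵥ v = 0 := by linarith
      -- both nonnegative summands vanish; the first puts `v` in the kernel of `H_cov`, i.e. `v = H⁻¹Fᵀβ` (§1), the second then contradicts `hβ`
      have hker : (H - Fᵀ * Mid⁻¹ * F) *ᵥ v = 0 := by
        -- PSD form vanishing ⟹ in the kernel (Cauchy–Schwarz, part 1)
        have hcs := dotProduct_mulVec_sq_le _ hcov v
          ((H - Fᵀ * Mid⁻¹ * F) *ᵥ v)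
        rw [h1z, mul_zero] at hcs
        exact dotProduct_self_eq_zero.mp (pow_eq_zero_iff two_ne_zero |>.mp (le_antisymm hcs (sq_nonneg _)))
      obtain ⟨β, rfl⟩ := (downdate_mulVec_eq_zero_iff H F Mid hH hF hMid v).mp hker
      have hβ0 : β ≠ 0 := by rintro rfl; exact hv (by rw [mulVec_zero])
      have h3 := hβ β hβ0
      have h2z : (Q *ᵥ (H⁻¹ * Fᵀ) *ᵥ β) ⬝ᵥ G *ᵥ (Q *ᵥ (H⁻¹ * Fᵀ) *ᵥ β) = 0 := by linarith
      rw [mulVec_mulVec, ← Matrix.mul_assoc] at h2z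
      rw [h2z] at h3
      exact lt_irrefl _ h3


/-! ## §3 The two-determinant form of `log Z` and the junction with H″ -/

/-- [folklore] **THE TWO-DETERMINANT FORM OF THE COVARIANT ONE SHOT (H‴)**: for `H ≻ 0`, `F H⁻¹ Fᵀ = Mid` invertible, `G ⪰ 0` positive on the
`S₀`-image and `Q` onto (`QQᵀ` invertible), with `H′ := H − FᵀMid⁻¹F + QᵀGQ`:
`logZ (H − FᵀMid⁻¹F) Q = ((|ν|−|μ|)/2)·log 2π − ½log|det H′| − ½log|det(QH′⁻¹Qᵀ)|` (`KKTSplit.logZ_split_reg` BY NAME, hypotheses discharged by (B)). -/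
theorem logZ_downdate_eq_two_det (H : Matrix ν ν ℝ) (Q : Matrix μ ν ℝ) (F : Matrix κ ν ℝ)
    (Mid : Matrix κ κ ℝ) (G : Matrix μ μ ℝ) (hH : H.PosDef) (hF : F * H⁻¹ * Fᵀ = Mid) (hMid : IsUnit Mid.det) (hG : G.PosSemidef)
    (hGS : ∀ β : κ → ℝ, β ≠ 0 → 0 < ((Q * H⁻¹ * Fᵀ) *ᵥ β) ⬝ᵥ G *ᵥ ((Q * H⁻¹ * Fᵀ) *ᵥ β)) (hQ : IsUnit (Q * Qᵀ).det) :
    logZ (H - Fᵀ * Mid⁻¹ * F) Q = ((Fintype.card ν : ℝ) - Fintype.card μ) / 2 * Real.log (2 * Real.pi)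
      - (1 / 2 : ℝ) * Real.log |(H - Fᵀ * Mid⁻¹ * F + Qᵀ * G * Q).det|
      - (1 / 2 : ℝ) * Real.log |(blockProp (H - Fᵀ * Mid⁻¹ * F + Qᵀ * G * Q) Q).det| := by
  have hpd := (posDef_add_conj_iff H Q F Mid G hH hF hMid hG).mpr hGS
  have hK : IsUnit (H - Fᵀ * Mid⁻¹ * F + Qᵀ * G * Q).det := (Matrix.isUnit_iff_isUnit_det _).mp hpd.isUnit
  have hP : IsUnit (blockProp (H - Fᵀ * Mid⁻¹ * F + Qᵀ * G * Q) Q).det :=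
    Literature.MathematicalPhysics.QuantumFieldTheory.Balaban1983to89.B9Eq3112.isUnit_det_QHinvQt _ hpd Q hQ
  exact Literature.MathematicalPhysics.QuantumFieldTheory.Balaban1983to89.Beta.KKTSplit.logZ_split_reg _ Q G hK hP

/-- [folklore] **THE JUNCTION H″ = H‴ (conservation of difficulty as an identity of log-determinants)**: under the hypotheses of (C) plus
`IsUnit (blockProp H Q).det` and `hK : IsUnit (Mid − FΓ₀Fᵀ).det` (part 2's three-plus-one form),
`½log|det H| + ½log|det(QH⁻¹Qᵀ)| + ½log|det(Mid − FΓ₀Fᵀ)| − ½log|det Mid| = ½log|det H′| + ½log|det(QH′⁻¹Qᵀ)|`, `H′ := H − FᵀMid⁻¹F + QᵀGQ`. -/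
theorem three_det_eq_two_det (H : Matrix ν ν ℝ) (Q : Matrix μ ν ℝ) (F : Matrix κ ν ℝ)
    (Mid : Matrix κ κ ℝ) (G : Matrix μ μ ℝ) (hH : H.PosDef) (hP0 : IsUnit (blockProp H Q).det) (hF : F * H⁻¹ * Fᵀ = Mid)
    (hMid : IsUnit Mid.det) (hK : IsUnit (Mid - F * flucCov H Q * Fᵀ).det) (hG : G.PosSemidef)
    (hGS : ∀ β : κ → ℝ, β ≠ 0 → 0 < ((Q * H⁻¹ * Fᵀ) *ᵥ β) ⬝ᵥ G *ᵥ ((Q * H⁻¹ * Fᵀ) *ᵥ β)) (hQ : IsUnit (Q * Qᵀ).det) :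
    (1 / 2 : ℝ) * Real.log |H.det| + (1 / 2 : ℝ) * Real.log |(blockProp H Q).det|
        + (1 / 2 : ℝ) * Real.log |(Mid - F * flucCov H Q * Fᵀ).det| - (1 / 2 : ℝ) * Real.log |Mid.det|
      = (1 / 2 : ℝ) * Real.log |(H - Fᵀ * Mid⁻¹ * F + Qᵀ * G * Q).det|
        + (1 / 2 : ℝ) * Real.log |(blockProp (H - Fᵀ * Mid⁻¹ * F + Qᵀ * G * Q) Q).det| := by
  have hHu : IsUnit H.det := (Matrix.isUnit_iff_isUnit_det H).mp hH.isUnit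
  have hkkt : IsUnit (kkt H Q).det :=
    isUnit_iff_ne_zero.mpr (det_kkt_ne_zero H Q hHu hP0)
  have h3 := Summit.QuantumFields.BalabanUV.Beta.FP.ResidualModeDeterminant.logZ_sub_deficit_three H Q F Mid hHu hkkt hMid hK
  have h2 := logZ_downdate_eq_two_det H Q F Mid G hH hF hMid hG hGS hQ
  linarith

/-! ## §4 The variational reading: the constrained minimum of `H_cov` through H‴ -/

omit [Fintype κ] [DecidableEq κ] [DecidableEq ν] [DecidableEq μ] in
/-- [folklore] ON THE CONSTRAINT FIBRE the coarse gauge fixing is a constant: `Qφ = a ⟹ φ ⬝ (K + QᵀGQ)φ = φ ⬝ Kφ + a ⬝ Ga`. -/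
theorem quad_add_conj_of_constraint (K : Matrix ν ν ℝ) (Q : Matrix μ ν ℝ) (G : Matrix μ μ ℝ) (φ : ν → ℝ) (a : μ → ℝ)
    (h : Q *ᵥ φ = a) : φ ⬝ᵥ (K + Qᵀ * G * Q) *ᵥ φ = φ ⬝ᵥ K *ᵥ φ + a ⬝ᵥ G *ᵥ a := by
  rw [add_mulVec, dotProduct_add, ← mulVec_mulVec, ← mulVec_mulVec, h, dotProduct_mulVec φ Qᵀ, vecMul_transpose, h]

/-- [folklore] **THE CONSTRAINED MINIMUM OF `H_cov` THROUGH H‴** (RHOA-DESIGN §4 «by S2 `min_{Q_Bφ=a}⟨φ,H′_nφ⟩ = …`», the ALGEBRA only):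
under §2's hypotheses, with `H′ := H − FᵀMid⁻¹F + QᵀGQ` (positive definite) and `φ₀ := minMap H′ Q a` (the Lagrange minimiser of the
dictionary's `Beta.Envelope`): `Qφ₀ = a`, **`φ₀ ⬝ H_cov φ₀ = a ⬝ ((QH′⁻¹Qᵀ)⁻¹ − G) a`**, and **`a ⬝ ((QH′⁻¹Qᵀ)⁻¹ − G) a ≤ φ ⬝ H_cov φ` for every
`φ` with `Qφ = a`** — the constrained minimum form of the SINGULAR `H_cov` is the H‴ block form minus the coarse gauge fixing, for EVERY
admissible `G` (the fixed-point value `n⁻⁴D²S_∞` of S2 ∕ RHOA-1 is NOT asserted). -/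
theorem constrained_min_downdate (H : Matrix ν ν ℝ) (Q : Matrix μ ν ℝ) (F : Matrix κ ν ℝ) (Mid : Matrix κ κ ℝ) (G : Matrix μ μ ℝ)
    (hH : H.PosDef) (hF : F * H⁻¹ * Fᵀ = Mid) (hMid : IsUnit Mid.det) (hG : G.PosSemidef)
    (hGS : ∀ β : κ → ℝ, β ≠ 0 → 0 < ((Q * H⁻¹ * Fᵀ) *ᵥ β) ⬝ᵥ G *ᵥ ((Q * H⁻¹ * Fᵀ) *ᵥ β)) (hQ : IsUnit (Q * Qᵀ).det)
    (a : μ → ℝ) :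
    Q *ᵥ (minMap (H - Fᵀ * Mid⁻¹ * F + Qᵀ * G * Q) Q *ᵥ a) = a
    ∧ (minMap (H - Fᵀ * Mid⁻¹ * F + Qᵀ * G * Q) Q *ᵥ a) ⬝ᵥ (H - Fᵀ * Mid⁻¹ * F) *ᵥ (minMap (H - Fᵀ * Mid⁻¹ * F + Qᵀ * G * Q) Q *ᵥ a)
        = a ⬝ᵥ ((blockProp (H - Fᵀ * Mid⁻¹ * F + Qᵀ * G * Q) Q)⁻¹ - G) *ᵥ a
    ∧ ∀ φ : ν → ℝ, Q *ᵥ φ = a →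
        a ⬝ᵥ ((blockProp (H - Fᵀ * Mid⁻¹ * F + Qᵀ * G * Q) Q)⁻¹ - G) *ᵥ a ≤ φ ⬝ᵥ (H - Fᵀ * Mid⁻¹ * F) *ᵥ φ := by
  set H' := H - Fᵀ * Mid⁻¹ * F + Qᵀ * G * Q with hH'
  have hpd : H'.PosDef := (posDef_add_conj_iff H Q F Mid G hH hF hMid hG).mpr hGS
  have hK : IsUnit H'.det := (Matrix.isUnit_iff_isUnit_det _).mp hpd.isUnit
  have hKs : H'ᵀ = H' := by rw [← conjTranspose_eq_transpose_of_trivial]; exact hpd.1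
  have hP : IsUnit (blockProp H' Q).det :=
    Literature.MathematicalPhysics.QuantumFieldTheory.Balaban1983to89.B9Eq3112.isUnit_det_QHinvQt _ hpd Q hQ
  have hQM : Q *ᵥ (minMap H' Q *ᵥ a) = a := by
    rw [mulVec_mulVec, constraint_mul_minMap H' Q hP, one_mulVec]
  -- the value of the H′-form at the minimiser
  have hval : (minMap H' Q *ᵥ a) ⬝ᵥ H' *ᵥ (minMap H' Q *ᵥ a) = a ⬝ᵥ (blockProp H' Q)⁻¹ *ᵥ a := by
    rw [← transpose_minMap_mul_mul_minMap H' Q hKs hK hP, ← mulVec_mulVec, ← mulVec_mulVec, dotProduct_mulVec a (minMap H' Q)ᵀ,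
      vecMul_transpose]
  -- pass from H′ to H_cov on the fibre
  have hfib0 := quad_add_conj_of_constraint (H - Fᵀ * Mid⁻¹ * F) Q G (minMap H' Q *ᵥ a) a hQM
  rw [← hH'] at hfib0
  have e : a ⬝ᵥ ((blockProp H' Q)⁻¹ - G) *ᵥ a = a ⬝ᵥ (blockProp H' Q)⁻¹ *ᵥ a - a ⬝ᵥ G *ᵥ a := by
    rw [sub_mulVec, dotProduct_sub]
  refine ⟨hQM, ?_, fun φ hφ => ?_⟩
  · rw [e]; linarith [hval, hfib0]
  · have hmin := quad_minMap_le H' Q hKs hpd.posSemidef hK hP φ a hφ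
    have hfib := quad_add_conj_of_constraint (H - Fᵀ * Mid⁻¹ * F) Q G φ a hφ
    rw [← hH'] at hfib
    rw [e]; linarith [hmin, hfib, hfib0, hval]

/-! ## §5 Under RHOA-1a's saturation letters (`FP/SliceSaturation`, owner d1-p3-g6, p241905): the H‴ block form is `S + G` -/

omit [Fintype κ] [DecidableEq κ] in
/-- [folklore] **THE BORDERED MATRIX OF THE DOWNDATED FORM IS INVERTIBLE AS SOON AS H‴ IS** (any `Hc`, any `G`): `(Hc + QᵀGQ) ≻ 0` and `QQᵀ`
invertible ⟹ `IsUnit (kkt Hc Q).det` (`KKTSplit.det_kkt_add_conj`: the bordered determinant does not see `QᵀGQ`). At `Hc := H − FᵀMid⁻¹F` this is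
the `IsUnit (kkt H_cov Q).det` of parts 1∕2, obtained from §2 WITHOUT ellipticity letters. -/
theorem isUnit_det_kkt_of_add_conj_posDef (Hc : Matrix ν ν ℝ) (Q : Matrix μ ν ℝ) (G : Matrix μ μ ℝ)
    (hpd : (Hc + Qᵀ * G * Q).PosDef) (hQ : IsUnit (Q * Qᵀ).det) : IsUnit (kkt Hc Q).det := by
  have hK : IsUnit (Hc + Qᵀ * G * Q).det := (Matrix.isUnit_iff_isUnit_det _).mp hpd.isUnit
  have hP : IsUnit (blockProp (Hc + Qᵀ * G * Q) Q).det :=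
    Literature.MathematicalPhysics.QuantumFieldTheory.Balaban1983to89.B9Eq3112.isUnit_det_QHinvQt _ hpd Q hQ
  rw [← det_kkt_add_conj Hc Q G]
  exact isUnit_iff_ne_zero.mpr (det_kkt_ne_zero _ Q hK hP)

omit [DecidableEq κ] in
/-- [folklore] **IN THE OWNER's SATURATION LETTERS** (`FP/SliceSaturation`: `H₀` symmetric with `H₀W = 0`, `QW = 0`, slice rows `E` saturated by
the orbit, `E = EWN`; the covariant downdated form presented as `Hc := H₀ + EᵀE`): for every coarse form `G`, the H‴ effective (block) form is
the GAUGE-INVARIANT VALUE FORM plus the coarse gauge fixing, **`effForm (H₀ + EᵀE + QᵀGQ) Q = minOpᵀ·H₀·minOp + G`**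
(`effForm_add_conj` + `effForm_eq_valueForm_of_saturated` BY NAME) — RHOA-DESIGN §4's «`S + H^c_gf`» at model level; the fixed-point VALUE of
`S` (S1, `n⁻⁴D²S_∞`) is NOT asserted. -/
theorem effForm_add_conj_of_saturated {ω : Type*} [Fintype ω] (H₀ : Matrix ν ν ℝ) (E : Matrix κ ν ℝ) (Q : Matrix μ ν ℝ)
    (W : Matrix ν ω ℝ) (N : Matrix ω ν ℝ) (G : Matrix μ μ ℝ) (hH : H₀ᵀ = H₀) (hHW : H₀ * W = 0) (hQW : Q * W = 0)
    (hsat : E = E * W * N) (h : IsUnit (kkt (H₀ + Eᵀ * E) Q).det) :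
    effForm (H₀ + Eᵀ * E + Qᵀ * G * Q) Q = (minOp (H₀ + Eᵀ * E) Q)ᵀ * H₀ * minOp (H₀ + Eᵀ * E) Q + G := by
  rw [effForm_add_conj _ Q G h, effForm_eq_valueForm_of_saturated H₀ E Q W N hH hHW hQW hsat h]

omit [DecidableEq κ] in
/-- [folklore] **`min_{Qφ=a}⟨φ,H′φ⟩ = ⟨a,(S + G)a⟩` UNDER RHOA-1a's HYPOTHESES** (RHOA-DESIGN §5 RHOA-9, second clause): in the saturation letters,
if moreover `H′ := H₀ + EᵀE + QᵀGQ ≻ 0` (§2 discharges this in the `H_BF` presentation) and `QQᵀ` is invertible, then with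
`S := minOp(Hc)ᵀ·H₀·minOp(Hc)`, `Hc := H₀ + EᵀE`:  `(QH′⁻¹Qᵀ)⁻¹ = S + G`, and for every `a`: `⟨a,(S+G)a⟩ ≤ ⟨φ,H′φ⟩` whenever `Qφ = a`, with
equality at the Lagrange minimiser `minMap H′ Q a` (which satisfies the constraint). -/
theorem constrained_min_selfSimilar_of_saturated {ω : Type*} [Fintype ω] (H₀ : Matrix ν ν ℝ) (E : Matrix κ ν ℝ) (Q : Matrix μ ν ℝ)
    (W : Matrix ν ω ℝ) (N : Matrix ω ν ℝ) (G : Matrix μ μ ℝ) (hH : H₀ᵀ = H₀) (hHW : H₀ * W = 0) (hQW : Q * W = 0)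
    (hsat : E = E * W * N) (hpd : (H₀ + Eᵀ * E + Qᵀ * G * Q).PosDef) (hQ : IsUnit (Q * Qᵀ).det) (a : μ → ℝ) :
    (blockProp (H₀ + Eᵀ * E + Qᵀ * G * Q) Q)⁻¹ = (minOp (H₀ + Eᵀ * E) Q)ᵀ * H₀ * minOp (H₀ + Eᵀ * E) Q + G
    ∧ Q *ᵥ (minMap (H₀ + Eᵀ * E + Qᵀ * G * Q) Q *ᵥ a) = a
    ∧ (minMap (H₀ + Eᵀ * E + Qᵀ * G * Q) Q *ᵥ a) ⬝ᵥ (H₀ + Eᵀ * E + Qᵀ * G * Q) *ᵥ (minMap (H₀ + Eᵀ * E + Qᵀ * G * Q) Q *ᵥ a)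
        = a ⬝ᵥ ((minOp (H₀ + Eᵀ * E) Q)ᵀ * H₀ * minOp (H₀ + Eᵀ * E) Q + G) *ᵥ a
    ∧ ∀ φ : ν → ℝ, Q *ᵥ φ = a →
        a ⬝ᵥ ((minOp (H₀ + Eᵀ * E) Q)ᵀ * H₀ * minOp (H₀ + Eᵀ * E) Q + G) *ᵥ a ≤ φ ⬝ᵥ (H₀ + Eᵀ * E + Qᵀ * G * Q) *ᵥ φ := by
  set H' := H₀ + Eᵀ * E + Qᵀ * G * Q with hH'
  have hK : IsUnit H'.det := (Matrix.isUnit_iff_isUnit_det _).mp hpd.isUnit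
  have hKs : H'ᵀ = H' := by rw [← conjTranspose_eq_transpose_of_trivial]; exact hpd.1
  have hP : IsUnit (blockProp H' Q).det :=
    Literature.MathematicalPhysics.QuantumFieldTheory.Balaban1983to89.B9Eq3112.isUnit_det_QHinvQt _ hpd Q hQ
  have hc : IsUnit (kkt (H₀ + Eᵀ * E) Q).det := isUnit_det_kkt_of_add_conj_posDef _ Q G hpd hQ
  have hS : (blockProp H' Q)⁻¹ = (minOp (H₀ + Eᵀ * E) Q)ᵀ * H₀ * minOp (H₀ + Eᵀ * E) Q + G := by
    rw [← effForm_eq_blockProp_inv H' Q hK hP, hH', effForm_add_conj_of_saturated H₀ E Q W N G hH hHW hQW hsat hc]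
  have hQM : Q *ᵥ (minMap H' Q *ᵥ a) = a := by
    rw [mulVec_mulVec, constraint_mul_minMap H' Q hP, one_mulVec]
  have hval : (minMap H' Q *ᵥ a) ⬝ᵥ H' *ᵥ (minMap H' Q *ᵥ a) = a ⬝ᵥ (blockProp H' Q)⁻¹ *ᵥ a := by
    rw [← transpose_minMap_mul_mul_minMap H' Q hKs hK hP, ← mulVec_mulVec, ← mulVec_mulVec, dotProduct_mulVec a (minMap H' Q)ᵀ,
      vecMul_transpose]
  refine ⟨hS, hQM, by rw [hval, hS], fun φ hφ => ?_⟩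
  rw [← hS, ← hval]
  exact quad_minMap_le H' Q hKs hpd.posSemidef hK hP φ a hφ

end Summit.QuantumFields.BalabanUV.Beta.FP.SelfSimilarBordering
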